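import Summits.ResolutionOfSingularities.ResolutionOfSingularities.Theorems.RisoStrataDescentAlgclosedToPerfectBlowupDescent
import Literature.AlgebraicGeometry.Resolution.ComponentGluing

/-!
# Line `rational-resolving-ideal` for crux `DescentAlgclosedToPerfect` (stmt-ResolutionOfSingularities-0550)

Seed line written by the line lead gen 1 (prover-line-stmt-ResolutionOfSingularities-0550-0,
2026-08-17) after all 14 payload lines proved to be lines of OTHER cruxes
(`Lines/payload-lines-ineligible-dead.md`). Card: `Lines/rational-resolving-ideal.md`; analysis and
tree pointers: `Cruxes/DescentAlgclosedToPerfect/NOTES.md`.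

Composition: `DescentAlgclosedToPerfect_of : stub_rationalResolvingIdeal → crux`, PROVED from the
landed transfer `Theorems.hasResolution_of_isBlowup_comap_fieldExtension` (p143851: a resolution of
`X_K` which is the blow-up of a non-zero ideal sheaf PULLED BACK FROM `X` descends to a resolution
of `X`, for any extension of fields `K/k`) and `ComponentGluing.hasResolution_of_forall_closeds`
(reduced ⇒ integral).

The single stub is the honest residue of the crux: from resolution over algebraically closed fields
(the antecedent, verbatim), produce for every INTEGRAL separated finite-type `X` over a PERFECT `k`
a `k`-RATIONAL resolving ideal — a non-zero ideal sheaf `J` on `X` whose base-changed blow-up over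
SOME field extension `σ : k → K` is regular. For `K/k` Galois this is a Galois-INVARIANT resolving
ideal on `X_K` (Galois descent of ideal sheaves, `Literature/AlgebraicGeometry/Motives/
GaloisDescentIdealSheaf.lean`, p146075); bare existence of a resolution of `X_{k̄}` gives an ideal
on `X_{k̄}` only, and every symmetrisation (norm ideal, join of conjugates, Weil restriction) gives
domination, not regularity — so the stub is crux-sized unless a canonicity input is supplied
(Kollár 2007, 3.34.2 / Thm. 3.36; BGMW 2011, Remark p. 23).
-/

noncomputable section

set_option linter.dupNamespace false

open CategoryTheory CategoryTheory.Limits AlgebraicGeometry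
open Literature.AlgebraicGeometry.Resolution

namespace Summit.ResolutionOfSingularities.ResolutionOfSingularities.Cruxes.DescentAlgclosedToPerfect.Lines.RationalResolvingIdeal

/-- STUB `stub_rationalResolvingIdeal` (OPEN — the residue of the crux): resolution over all
algebraically closed fields of characteristic `p` yields, for every integral separated scheme `X` of
finite type over a perfect field `k` of characteristic `p`, an extension of fields `σ : k → K`, a
non-zero ideal sheaf `J` on `X` and a REGULAR blow-up of `X ×_k K` along `J·𝒪`. -/
theorem stub_rationalResolvingIdeal : ∀ p : ℕ, p.Prime →
    (∀ (k : Type) [Field k] [CharP k p] [IsAlgClosed k] (X : Scheme.{0}) (f : X ⟶ Spec (.of k)),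
      IsSeparated f → LocallyOfFiniteType f → QuasiCompact f → IsReduced X →
      Scheme.HasResolution X) →
    ∀ (k : Type) [Field k] [CharP k p] [PerfectField k] (X : Scheme.{0}) (f : X ⟶ Spec (.of k)),
      IsSeparated f → LocallyOfFiniteType f → QuasiCompact f → IsIntegral X →
      ∃ (K : Type) (_ : Field K) (σ : k →+* K) (J : X.IdealSheafData) (Y : Scheme.{0})
        (ρ : Y ⟶ pullback f (Spec.map (CommRingCat.ofHom σ))),
        J ≠ ⊥ ∧ IsBlowup ρ (J.comap (pullback.fst f (Spec.map (CommRingCat.ofHom σ)))) ∧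
          Scheme.IsRegular Y := by
  sorry

/-- COMPOSITION: the stub gives the crux BY NAME (reduced ⇒ integral by resolving the integral closed
subschemes and gluing; then descend the blow-up along the field extension). -/
theorem DescentAlgclosedToPerfect_of :
    Summit.ResolutionOfSingularities.ResolutionOfSingularities.Theses.RisoStrata.DescentAlgclosedToPerfect := by
  intro p hp hA k _ _ _ X f hs hl hq hr
  refine ComponentGluing.hasResolution_of_forall_closeds X f fun Z hZ => ?_
  haveI := hZ
  obtain ⟨K, _, σ, J, Y, ρ, hJ, hρ, hY⟩ :=
    stub_rationalResolvingIdeal p hp hA k _ ((Scheme.IdealSheafData.vanishingIdeal Z).subschemeι ≫ f)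
      inferInstance inferInstance inferInstance hZ
  haveI : IsLocallyNoetherian (Scheme.IdealSheafData.vanishingIdeal Z).subscheme :=
    LocallyOfFiniteType.isLocallyNoetherian ((Scheme.IdealSheafData.vanishingIdeal Z).subschemeι ≫ f)
  exact Theorems.hasResolution_of_isBlowup_comap_fieldExtension σ _ hJ hρ hY

end Summit.ResolutionOfSingularities.ResolutionOfSingularities.Cruxes.DescentAlgclosedToPerfect.Lines.RationalResolvingIdeal

end
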